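import Summits.HodgeConjecture.CorCM.DecicWeil23PairTwoTransitiveTransfer
import Summits.HodgeConjecture.CorCM.DecicWeil23PairHodgeOfMarkman
import HarnessLib

/-!
# COR-CM — the Hodge conjecture for every product of copies of `E, B₁, B₂` (two CM fivefolds of `k`-signature `(2,3)` over one
# DECIC CM field `K ⊇ i(k)`, the CM curve of `k`) GIVEN ONLY Markman's hyperbolic-sixfold theorem — under `2`-TRANSITIVITY of
# `Aut(ℂ/k)` on the five embeddings over `τ` (quintic part `S₅`, `A₅` OR the Frobenius group `F₂₀`)

Cell `pub-hodgecm2` (COR-CM), seat b30 gen 23 (2026-08-22); count-neutral own lane DECIC-2T (gen 22's NEXT SIZED ITEM).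
Theorems only; no definition, no named fact, no `sorry`.  HONEST FRAMING: CONDITIONAL on the single displayed named fact
`HodgeTheory.Markman2025_weilClasses_algebraic_hyperbolicSixfold` (E. Markman, arXiv:2502.03415 Thm 1.5.1 — UNREFEREED); `HC_CM`
is not asserted and no case of the Hodge conjecture is claimed unconditionally.

WHAT IS NEW.  Gen 22's theorems (`CorCM/DecicWeil23PairPowersHodgeOfMarkman`, `…HodgeOfMarkman`) assumed that `Aut(ℂ/k)` permutes
the five embeddings of `K` over `τ` `3`-TRANSITIVELY (totally real quintic `K⁺` with Galois group `A₅` or `S₅`), so that all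
sixty even permutations of the conjugate pairs are realised and the tabulated defect law applies.  By
`Census/DecicWeil23PairTwoTransitive` the defect law already follows from `2`-TRANSITIVITY (an averaging argument over the
fibres of the realised permutations, which form a composition-closed `2`-transitive set: `CorCM/DecicWeil23PairTwoTransitiveTransfer`),
so every Galois-balanced weight satisfies the sixty `A₅`-equations and gen 22's assembly runs unchanged.  The new case covered is
the Frobenius group `F₂₀` (sharply `2`-transitive, solvable) as Galois group of `K⁺`.

* §1 **`hodgeConjectureFor_biproduct_comp_of_frameD_of_markmanSixfold_of_transfer`** — gen 22's assembly with the frame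
  transfer abstracted into a hypothesis (`htr`: every `Aut(ℂ)`-balanced weight of `⨁_j A₃(κ j)` is a balanced configuration of
  the kernel census); **`…_h2t`** — the frame form under `2`-transitivity; the `AVDominatedBy` form.
* §2 **`hodgeConjectureFor_biproduct_comp_vec_of_markmanD_h2T`** — INTRINSIC: `K ⊇ i(k)` a CM field of degree `10`, `k`
  imaginary quadratic, `B₁ ⊨ (K; Φ₁)`, `B₂ ⊨ (K; Φ₂)` CM abelian FIVEFOLDS of `k`-signature `(2,3)` with `Φ₁ ≠ Φ₂`,
  `E ⊨ (k; Ψ ∋ τ)`, and `Aut(ℂ)` `2`-TRANSITIVE on the five embeddings of `K` over `τ`: the Hodge conjecture for every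
  `⨁_j ![E, B₁, B₂](κ j)` (all `E^a × B₁^{n₁} × B₂^{n₂}`) and for everything such a product dominates.
The family and one-type forms follow in `CorCM/DecicWeil23PairTwoTransitiveFamilyHodgeOfMarkman.lean`.
[cite: Markman2025SecantWeil, Thm 1.5.1] [cite: Pohlmann1968, Thm 1] [cite: Milne2020HodgeClassesAV, 1.2 (a) and Thm. 1]
[cite: Deligne1982HodgeCycles, §4 Prop. 4.4 and §5 (c)] [cite: Schoen1998HodgeWeilAddendum, §10] [cite: DixonMortimer1996, §2.1]

## References
* [Markman2025SecantWeil] E. Markman, arXiv:2502.03415 (unrefereed), Thm 1.5.1.  [Pohlmann1968] H. Pohlmann, Ann. of Math. 88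
  (1968), Thm 1.  [Milne2020HodgeClassesAV] J. S. Milne, arXiv:2010.08857, 1.2 (a), Thm. 1.  [Deligne1982HodgeCycles]
  P. Deligne, LNM 900 (1982), §4 Prop. 4.4, §5 (c).  [Schoen1998HodgeWeilAddendum] C. Schoen, Compositio Math. 114 (1998), §10.
  [DixonMortimer1996] J. D. Dixon, B. Mortimer, *Permutation Groups*, GTM 163 (1996), §2.1.  [MumfordAV1970] D. Mumford,
  *Abelian Varieties*, §19.
-/

noncomputable section

open CategoryTheory CategoryTheory.Limits NumberField

namespace Summit.HodgeConjecture.CorCM.DecicWeil23Pair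

open Literature.AlgebraicGeometry Literature.AlgebraicGeometry.Motives Literature.AlgebraicGeometry.HodgeTheory
open Literature.AlgebraicGeometry.ComplexMultiplication (IsCMTypeRealisation)
open Literature.AlgebraicGeometry.Pohlmann1968
open Literature.AlgebraicTopology.SingularHomology
open Literature.NumberTheory.ComplexMultiplication
open Summit.HodgeConjecture.CorCM.Census.DecicWeil23Pair (PtD inPos ModelBalancedD IsPairPartD IsSixPartD IsTenPartD
  modelBalancedD_induction)
open Summit.HodgeConjecture.CorCM.OcticCurveFourfold (exists_delta_of_mem)
open Summit.HodgeConjecture.CorCM.PairWeights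

open scoped Classical Pointwise

/-! ## §1 The frame form: assembly over an abstract frame transfer; `2`-transitivity -/

section Assembly

variable {I : Type} {Kf : I → Type} [∀ i, Field (Kf i)] [∀ i, NumberField (Kf i)] [∀ i, IsCMField (Kf i)]
  {i₀ i₁ : I} {τ : Kf i₀ →+* ℂ} {e : (Kf i₁ →+* ℂ) ≃ Fin 5 × Bool} {i : Kf i₀ →+* Kf i₁} {c : Bool}
  {A₃ : Fin 3 → AbelianVariety ℂ} {Φ₃ : ∀ j : Fin 3, CMType (Kf (pairSlots i₀ i₁ j))}
  {ι₃ : ∀ j, 𝓞 (Kf (pairSlots i₀ i₁ j)) →+* End (A₃ j)}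
  {θ₃ : ∀ j, Kf (pairSlots i₀ i₁ j) →+* Module.End ℂ (complexBetti (A₃ j).X 1)}

/-- **ASSEMBLY OVER AN ABSTRACT FRAME TRANSFER.**  Gen 22's main theorem
`hodgeConjectureFor_biproduct_comp_of_frameD_of_markmanSixfold` with its Galois input isolated: the Hodge conjecture for the
product of copies `⨁_j A₃(κ j)` of `E ⊨ (k; {τ})`, `B₁ ⊨ (K; Φ₀)`, `B₂ ⊨ (K; Φ₁)` (two `(2,3)`-types read at the normal positions of
the frame `e`) follows from Markman's sixfold theorem AS SOON AS every `Aut(ℂ)`-balanced weight of `⨁_j A₃(κ j)` is a balanced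
configuration of the kernel census `Census/DecicWeil23Pair` (`htr`) — then it is a disjoint union of pair parts (divisor lines),
Weil sixfold parts of `B_m × E` (Markman, via seat b09's aiming theorem and the type count `(3,3)`) and tenfold parts of `B₁ × B̄₂`
(push-pull through `E ⊞ E ⊞ X`), and Pohlmann's theorem concludes. [cite: Markman2025SecantWeil, Thm 1.5.1] [cite: Pohlmann1968, Thm 1]
[cite: Milne2020HodgeClassesAV, 1.2 (a) and Thm. 1] [cite: Schoen1998HodgeWeilAddendum, §10] -/
theorem hodgeConjectureFor_biproduct_comp_of_frameD_of_markmanSixfold_of_transfer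
    (hM6 : Markman2025_weilClasses_algebraic_hyperbolicSixfold)
    {N : ℕ} (κ : Fin N → Fin 3) (h10 : Module.finrank ℚ (Kf i₁) = 10) (h2 : Module.finrank ℚ (Kf i₀) = 2) (i : Kf i₀ →+* Kf i₁)
    {δ : 𝓞 (Kf i₀)} {d : ℕ} (hd : 0 < d) (hδ : ((δ : Kf i₀)) ^ 2 = -(d : Kf i₀))
    (hτ : τ (δ : Kf i₀) = Complex.I * (Real.sqrt d : ℂ))
    (hA : ∀ j, IsCMTypeRealisation (Φ₃ j) (A₃ j) (ι₃ j) (θ₃ j))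
    (e : (Kf i₁ →+* ℂ) ≃ Fin 5 × Bool)
    (he_sign : ∀ s : Kf i₁ →+* ℂ, (e s).2 = true ↔ s.comp i = τ)
    (he_conj : ∀ s : Kf i₁ →+* ℂ, e (ComplexEmbedding.conjugate s) = ((e s).1, !(e s).2))
    (hΦ : ∀ (m : Fin 2) (s : Kf i₁ →+* ℂ), s ∈ (Φ₃ m.succ).1 ↔ (e s).2 = inPos c m (e s).1)
    (hΨ : ∀ σ : Kf i₀ →+* ℂ, σ ∈ (Φ₃ 0).1 ↔ σ = τ)
    (htr : ∀ S : Finset ((j : Fin N) × (Kf (pairSlots i₀ i₁ (κ j)) →+* ℂ)),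
      IsGaloisBalancedAlg (K := fun j => Kf (pairSlots i₀ i₁ (κ j))) (fun j => Φ₃ (κ j)) S →
      ModelBalancedD c (fun x => toPtD e τ ((Sigma.map κ (fun _ => id) :
        ((j : Fin N) × (Kf (pairSlots i₀ i₁ (κ j)) →+* ℂ)) → ((m : Fin 3) × (Kf (pairSlots i₀ i₁ m) →+* ℂ))) x)) S) :
    HodgeConjectureFor (⨁ fun j => A₃ (κ j)).dim (⨁ fun j => A₃ (κ j)).X := by
  have hττ : ComplexEmbedding.conjugate τ ≠ τ := QuarticCM.conjugate_ne τ
  have hk : ∀ σ : Kf i₀ →+* ℂ, σ = τ ∨ σ = ComplexEmbedding.conjugate τ := fun σ =>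
    QuarticCM.eq_or_eq_conjugate_of_quadratic h2 τ σ
  -- the Weil planes of `B₁ × E` and `B₂ × E`, algebraic by Markman's sixfold theorem
  have hW := weilClassesOf_sixfold_le_algebraicClasses_of_frameD_of_markmanSixfold hM6 h10 h2 i hd hδ hA he_sign hΦ hΨ
  -- sixfold parts of any product of copies (used on `X` and on `X⁺ = E ⊞ E ⊞ X`)
  have hsix : ∀ {N' : ℕ} (κ' : Fin N' → Fin 3) (m : Fin 2) (c' : Bool)
      (G' : Finset ((j : Fin N') × (Kf (pairSlots i₀ i₁ (κ' j)) →+* ℂ))),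
      IsSixPartD (fun x => toPtD e τ ((Sigma.map κ' (fun _ => id) :
        ((j : Fin N') × (Kf (pairSlots i₀ i₁ (κ' j)) →+* ℂ)) → ((l : Fin 3) × (Kf (pairSlots i₀ i₁ l) →+* ℂ))) x)) m c' G' →
      G'.card = 2 * 3 ∧ weightClassesAlg (fun j => A₃ (κ' j)) (fun j => ι₃ (κ' j)) (2 * 3) G' ≤
        algebraicClasses (⨁ fun j => A₃ (κ' j)).X 3 :=
    fun κ' m c' G' hG' => weightClassesAlg_le_algebraicClasses_of_isSixPartD hk he_sign hA hτ hW κ' hG'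
  refine ⟨nonempty_hodgeModel_holds (Motives.AbelianVariety.isSmoothProjective_holds (A := ⨁ fun j => A₃ (κ j))),
    fun p cl hc hH => ?_⟩
  have hAκ : ∀ j, IsCMTypeRealisation (Φ₃ (κ j)) (A₃ (κ j)) (ι₃ (κ j)) (θ₃ (κ j)) := fun j => hA (κ j)
  -- every balanced configuration has algebraic weight lines: induct over its generating parts
  have key : ∀ (R : Finset ((j : Fin N) × (Kf (pairSlots i₀ i₁ (κ j)) →+* ℂ))),
      ModelBalancedD c (fun x => toPtD e τ ((Sigma.map κ (fun _ => id) :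
        ((j : Fin N) × (Kf (pairSlots i₀ i₁ (κ j)) →+* ℂ)) → ((m : Fin 3) × (Kf (pairSlots i₀ i₁ m) →+* ℂ))) x)) R →
      ∀ q, R.card = 2 * q → weightClassesAlg (fun j => A₃ (κ j)) (fun j => ι₃ (κ j)) (2 * q) R ≤
        algebraicClasses (⨁ fun j => A₃ (κ j)).X q := by
    intro R hR
    refine modelBalancedD_induction (motive := fun R => ∀ q, R.card = 2 * q →
      weightClassesAlg (fun j => A₃ (κ j)) (fun j => ι₃ (κ j)) (2 * q) R ≤ algebraicClasses (⨁ fun j => A₃ (κ j)).X q)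
      (fun q hq => ?_) (fun G R hGR hG ih q hq => ?_) (fun G R m b hGR hG ih q hq => ?_)
      (fun G R b hGR hG ih q hq => ?_) hR
    · obtain rfl : q = 0 := by simpa using hq.symm
      exact fun c' _ => hodgeConjectureFor_codim_zero c'
    · -- a pair part: a divisor line
      obtain ⟨ha, hGalg⟩ := weightClassesAlg_le_algebraicClasses_of_isPairPartD κ hττ hk he_conj hA hG
      have hRcard : R.card = 2 * (q - 1) := by
        have h := Finset.card_union_of_disjoint hGR; rw [hq, ha] at h; omega
      have haq : 1 + (q - 1) = q := by
        have h := Finset.card_union_of_disjoint hGR; rw [hq, ha] at h; omega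
      rw [← Finset.disjUnion_eq_union G R hGR]
      exact weightClassesAlg_union_le_algebraicClasses hAκ haq ha hRcard hGR hGalg (ih (q - 1) hRcard)
    · -- a sixfold part of `B_m × E`: Markman's sixfold theorem
      obtain ⟨ha, hGalg⟩ := hsix κ m b G hG
      have hRcard : R.card = 2 * (q - 3) := by
        have h := Finset.card_union_of_disjoint hGR; rw [hq, ha] at h; omega
      have haq : 3 + (q - 3) = q := by
        have h := Finset.card_union_of_disjoint hGR; rw [hq, ha] at h; omega
      rw [← Finset.disjUnion_eq_union G R hGR]
      exact weightClassesAlg_union_le_algebraicClasses hAκ haq ha hRcard hGR hGalg (ih (q - 3) hRcard)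
    · -- a tenfold part of `B₁ × B̄₂`: push-pull through `E ⊞ E ⊞ X`, the sixfold parts there
      obtain ⟨ha, hGalg⟩ := weightClassesAlg_le_algebraicClasses_of_isTenPartD κ hττ hk he_conj hA
        (fun m c' G' hG' => (hsix (ext₂ κ) m c' G' hG').2) hG
      have hRcard : R.card = 2 * (q - 5) := by
        have h := Finset.card_union_of_disjoint hGR; rw [hq, ha] at h; omega
      have haq : 5 + (q - 5) = q := by
        have h := Finset.card_union_of_disjoint hGR; rw [hq, ha] at h; omega
      rw [← Finset.disjUnion_eq_union G R hGR]
      exact weightClassesAlg_union_le_algebraicClasses hAκ haq ha hRcard hGR hGalg (ih (q - 5) hRcard)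
  have hmem : cl ∈ ⨆ S ∈ pohlmannSetsAlg (K := fun j => Kf (pairSlots i₀ i₁ (κ j))) (fun j => Φ₃ (κ j)) p,
      weightClassesAlg (fun j => A₃ (κ j)) (fun j => ι₃ (κ j)) (2 * p) S := by
    rw [← (Pohlmann1968_thm1_cmAlgebra (fun j => Kf (pairSlots i₀ i₁ (κ j))) (fun j => A₃ (κ j))
      (fun j => Φ₃ (κ j)) (fun j => ι₃ (κ j)) (fun j => θ₃ (κ j)) hAκ p).1]
    exact Submodule.subset_span ⟨hc, hH⟩
  have hle : (⨆ S ∈ pohlmannSetsAlg (K := fun j => Kf (pairSlots i₀ i₁ (κ j))) (fun j => Φ₃ (κ j)) p,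
      weightClassesAlg (fun j => A₃ (κ j)) (fun j => ι₃ (κ j)) (2 * p) S) ≤
      algebraicClasses (⨁ fun j => A₃ (κ j)).X p := by
    refine iSup₂_le fun S hS => ?_
    exact key S (htr S hS.2) p hS.1
  exact hle hmem

/-- **MAIN THEOREM (frame form, `2`-TRANSITIVITY).  The Hodge conjecture for every product of copies `⨁_j A₃(κ j)` of
`E, B₁, B₂` — all `E^a × B₁^{n₁} × B₂^{n₂}` — GIVEN ONLY Markman's hyperbolic-sixfold theorem**, for `E ⊨ (k; {τ})`,
`B₁ ⊨ (K; Φ₀)`, `B₂ ⊨ (K; Φ₁)` CM fivefolds of `k`-signature `(2,3)` over a decic CM field `K ⊇ i(k)` (types read in a frame `e`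
at the positions `I_0 = {0,1}`, `I_1 = {1,2}` / `{3,2}`), whose conjugate pairs are permuted `2`-TRANSITIVELY by `Aut(ℂ)` (`h2t`:
every ordered pair of distinct pairs is moved to `(0, 1)`; the totally real quintic `K⁺` has Galois group `S₅`, `A₅` or `F₂₀`).
Leaf: the Markman fact ONLY. [cite: Markman2025SecantWeil, Thm 1.5.1] [cite: Pohlmann1968, Thm 1] [cite: DixonMortimer1996, §2.1] -/
theorem hodgeConjectureFor_biproduct_comp_of_frameD_of_markmanSixfold_h2t
    (hM6 : Markman2025_weilClasses_algebraic_hyperbolicSixfold)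
    {N : ℕ} (κ : Fin N → Fin 3) (h10 : Module.finrank ℚ (Kf i₁) = 10) (h2 : Module.finrank ℚ (Kf i₀) = 2) (i : Kf i₀ →+* Kf i₁)
    {δ : 𝓞 (Kf i₀)} {d : ℕ} (hd : 0 < d) (hδ : ((δ : Kf i₀)) ^ 2 = -(d : Kf i₀))
    (hτ : τ (δ : Kf i₀) = Complex.I * (Real.sqrt d : ℂ))
    (hA : ∀ j, IsCMTypeRealisation (Φ₃ j) (A₃ j) (ι₃ j) (θ₃ j))
    (e : (Kf i₁ →+* ℂ) ≃ Fin 5 × Bool)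
    (he_sign : ∀ s : Kf i₁ →+* ℂ, (e s).2 = true ↔ s.comp i = τ)
    (he_conj : ∀ s : Kf i₁ →+* ℂ, e (ComplexEmbedding.conjugate s) = ((e s).1, !(e s).2))
    (hΦ : ∀ (m : Fin 2) (s : Kf i₁ →+* ℂ), s ∈ (Φ₃ m.succ).1 ↔ (e s).2 = inPos c m (e s).1)
    (hΨ : ∀ σ : Kf i₀ →+* ℂ, σ ∈ (Φ₃ 0).1 ↔ σ = τ)
    (h2t : ∀ a b : Fin 5, a ≠ b → ∃ ρ : ℂ ≃+* ℂ,
      (ρ : ℂ →+* ℂ).comp (e.symm (a, true)) = e.symm (0, true) ∧ (ρ : ℂ →+* ℂ).comp (e.symm (b, true)) = e.symm (1, true)) :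
    HodgeConjectureFor (⨁ fun j => A₃ (κ j)).dim (⨁ fun j => A₃ (κ j)).X :=
  hodgeConjectureFor_biproduct_comp_of_frameD_of_markmanSixfold_of_transfer hM6 κ h10 h2 i hd hδ hτ hA e he_sign he_conj hΦ hΨ
    fun _ hS => modelBalancedD_of_isGaloisBalancedAlg_h2t (QuarticCM.conjugate_ne τ)
      (fun σ => QuarticCM.eq_or_eq_conjugate_of_quadratic h2 τ σ) he_sign he_conj hΦ hΨ κ h2t hS

/-- **The Hodge conjecture for every abelian variety dominated by a product of copies `⨁_j A₃(κ j)`** (frame form,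
`2`-transitivity, modulo Markman's sixfold theorem). [cite: Markman2025SecantWeil, Thm 1.5.1] [cite: MumfordAV1970, §19] -/
theorem hodgeConjectureFor_of_avDominatedBy_comp_of_frameD_of_markmanSixfold_h2t
    (hM6 : Markman2025_weilClasses_algebraic_hyperbolicSixfold)
    {N : ℕ} (κ : Fin N → Fin 3) (h10 : Module.finrank ℚ (Kf i₁) = 10) (h2 : Module.finrank ℚ (Kf i₀) = 2) (i : Kf i₀ →+* Kf i₁)
    {δ : 𝓞 (Kf i₀)} {d : ℕ} (hd : 0 < d) (hδ : ((δ : Kf i₀)) ^ 2 = -(d : Kf i₀))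
    (hτ : τ (δ : Kf i₀) = Complex.I * (Real.sqrt d : ℂ))
    (hA : ∀ j, IsCMTypeRealisation (Φ₃ j) (A₃ j) (ι₃ j) (θ₃ j))
    (e : (Kf i₁ →+* ℂ) ≃ Fin 5 × Bool)
    (he_sign : ∀ s : Kf i₁ →+* ℂ, (e s).2 = true ↔ s.comp i = τ)
    (he_conj : ∀ s : Kf i₁ →+* ℂ, e (ComplexEmbedding.conjugate s) = ((e s).1, !(e s).2))
    (hΦ : ∀ (m : Fin 2) (s : Kf i₁ →+* ℂ), s ∈ (Φ₃ m.succ).1 ↔ (e s).2 = inPos c m (e s).1)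
    (hΨ : ∀ σ : Kf i₀ →+* ℂ, σ ∈ (Φ₃ 0).1 ↔ σ = τ)
    (h2t : ∀ a b : Fin 5, a ≠ b → ∃ ρ : ℂ ≃+* ℂ,
      (ρ : ℂ →+* ℂ).comp (e.symm (a, true)) = e.symm (0, true) ∧ (ρ : ℂ →+* ℂ).comp (e.symm (b, true)) = e.symm (1, true))
    {X : AbelianVariety ℂ} (hX : Domination.AVDominatedBy X (⨁ fun j => A₃ (κ j))) :
    HodgeConjectureFor X.dim X.X :=
  Domination.hodgeConjectureFor_of_avDominatedBy
    (hodgeConjectureFor_biproduct_comp_of_frameD_of_markmanSixfold_h2t hM6 κ h10 h2 i hd hδ hτ hA e he_sign he_conj hΦ hΨ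
      h2t) hX

end Assembly

/-! ## §2 The intrinsic theorem under `2`-transitivity -/

section Main

variable {K : Type} [Field K] [NumberField K] [IsCMField K] {k : Type} [Field k] [NumberField k] [IsCMField k] {N : ℕ}
  {Φ₁ Φ₂ : CMType K} {B₁ B₂ : AbelianVariety ℂ}
  {ι₁ : 𝓞 K →+* End B₁} {θ₁ : K →+* Module.End ℂ (complexBetti B₁.X 1)}
  {ι₂ : 𝓞 K →+* End B₂} {θ₂ : K →+* Module.End ℂ (complexBetti B₂.X 1)}
  {Ψ : CMType k} {E : AbelianVariety ℂ} {ιE : 𝓞 k →+* End E} {θE : k →+* Module.End ℂ (complexBetti E.X 1)}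

omit [IsCMField K] [IsCMField k] in
/-- **`3`-transitivity ⟹ `2`-transitivity (intrinsic forms)**: an injective pair of embeddings of `K` over `τ` extends to an
injective triple (the fibre of `τ` has five elements, `DecicCurveFivefold.card_filter_comp_eq_five`), so gen 22's hypothesis `h3T`
implies `h2T` and every theorem below contains its `3`-transitive predecessor. [folklore] -/
theorem twoTransitive_of_threeTransitive (h10 : Module.finrank ℚ K = 10) (h2 : Module.finrank ℚ k = 2) (i : k →+* K)
    {τ : k →+* ℂ}
    (h3T : ∀ x y : Fin 3 ↪ {s : K →+* ℂ // s.comp i = τ}, ∃ ρ : ℂ ≃+* ℂ, ∀ j : Fin 3, (ρ : ℂ →+* ℂ).comp (x j).1 = (y j).1)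
    (x y : Fin 2 ↪ {s : K →+* ℂ // s.comp i = τ}) :
    ∃ ρ : ℂ ≃+* ℂ, ∀ j : Fin 2, (ρ : ℂ →+* ℂ).comp (x j).1 = (y j).1 := by
  -- a third point of the fibre outside the range of an injective pair
  have hthird : ∀ z : Fin 2 ↪ {s : K →+* ℂ // s.comp i = τ}, ∃ w : {s : K →+* ℂ // s.comp i = τ}, w ≠ z 0 ∧ w ≠ z 1 := by
    intro z
    have hlt : ({(z 0).1, (z 1).1} : Finset (K →+* ℂ)).card <
        (Finset.univ.filter fun s : K →+* ℂ => s.comp i = τ).card := by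
      rw [DecicCurveFivefold.card_filter_comp_eq_five i h10 h2 τ]
      exact lt_of_le_of_lt Finset.card_le_two (by norm_num)
    obtain ⟨s, hs, hs'⟩ := Finset.exists_mem_notMem_of_card_lt_card hlt
    refine ⟨⟨s, (Finset.mem_filter.1 hs).2⟩, fun h => hs' ?_, fun h => hs' ?_⟩
    · rw [Finset.mem_insert]; exact Or.inl (congrArg Subtype.val h)
    · rw [Finset.mem_insert, Finset.mem_singleton]; exact Or.inr (congrArg Subtype.val h)
  -- extension to injective triples
  have hext : ∀ z : Fin 2 ↪ {s : K →+* ℂ // s.comp i = τ}, ∃ z' : Fin 3 ↪ {s : K →+* ℂ // s.comp i = τ},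
      z' 0 = z 0 ∧ z' 1 = z 1 := by
    intro z
    obtain ⟨w, hw0, hw1⟩ := hthird z
    have h01 : z 0 ≠ z 1 := fun h => by simpa using z.injective h
    refine ⟨⟨![z 0, z 1, w], fun j j' h => ?_⟩, rfl, rfl⟩
    fin_cases j <;> fin_cases j'
    · rfl
    · exact absurd h h01
    · exact absurd h hw0.symm
    · exact absurd h h01.symm
    · rfl
    · exact absurd h hw1.symm
    · exact absurd h hw0
    · exact absurd h hw1
    · rfl
  obtain ⟨x', hx0, hx1⟩ := hext x
  obtain ⟨y', hy0, hy1⟩ := hext y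
  obtain ⟨ρ, hρ⟩ := h3T x' y'
  exact ⟨ρ, Fin.forall_fin_two.2 ⟨by rw [← hx0, ← hy0]; exact hρ 0, by rw [← hx1, ← hy1]; exact hρ 1⟩⟩

/-- **THE HODGE CONJECTURE FOR EVERY PRODUCT OF COPIES OF `E, B₁, B₂`, GIVEN ONLY Markman's hyperbolic-sixfold theorem —
`2`-TRANSITIVE form.**  `B₁ ⊨ (K; Φ₁)` and `B₂ ⊨ (K; Φ₂)` CM abelian FIVEFOLDS with CM by one field `K ⊇ i(k)` of degree `10`,
of `k`-signature `(2,3)` (`h23₁`, `h23₂`) and of DIFFERENT types (`hne`), `E ⊨ (k; Ψ ∋ τ)` the CM elliptic curve, and `Aut(ℂ)`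
`2`-TRANSITIVE on the five embeddings of `K` over `τ` (`h2T`: the totally real quintic subfield has Galois group `S₅`, `A₅` or
the Frobenius group `F₂₀`): for every `κ : Fin N → Fin 3`, every rational `(q,q)`-class on `⨁_j ![E, B₁, B₂] (κ j)` is algebraic.
Supersedes gen 22's `hodgeConjectureFor_biproduct_comp_vec_of_markmanD` (`3`-transitivity).
[cite: Markman2025SecantWeil, Thm 1.5.1] [cite: Pohlmann1968, Thm 1] [cite: Deligne1982HodgeCycles, §5 (c)]
[cite: Schoen1998HodgeWeilAddendum, §10] [cite: DixonMortimer1996, §2.1] -/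
theorem hodgeConjectureFor_biproduct_comp_vec_of_markmanD_h2T
    (hM6 : Markman2025_weilClasses_algebraic_hyperbolicSixfold)
    (h10 : Module.finrank ℚ K = 10) (h2 : Module.finrank ℚ k = 2) (i : k →+* K)
    (hB₁ : IsCMTypeRealisation Φ₁ B₁ ι₁ θ₁) (hB₂ : IsCMTypeRealisation Φ₂ B₂ ι₂ θ₂) (hE : IsCMTypeRealisation Ψ E ιE θE)
    {τ : k →+* ℂ} (hτΨ : τ ∈ Ψ.1)
    (h23₁ : (Finset.univ.filter fun s : K →+* ℂ => s.comp i = τ ∧ s ∈ Φ₁.1).card = 2)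
    (h23₂ : (Finset.univ.filter fun s : K →+* ℂ => s.comp i = τ ∧ s ∈ Φ₂.1).card = 2) (hne : Φ₁ ≠ Φ₂)
    (h2T : ∀ x y : Fin 2 ↪ {s : K →+* ℂ // s.comp i = τ}, ∃ ρ : ℂ ≃+* ℂ, ∀ j : Fin 2, (ρ : ℂ →+* ℂ).comp (x j).1 = (y j).1)
    (κ : Fin N → Fin 3) :
    HodgeConjectureFor (⨁ fun j => (![E, B₁, B₂] : Fin 3 → AbelianVariety ℂ) (κ j)).dim
      (⨁ fun j => (![E, B₁, B₂] : Fin 3 → AbelianVariety ℂ) (κ j)).X := by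
  have hττ : ComplexEmbedding.conjugate τ ≠ τ := QuarticCM.conjugate_ne τ
  have hk : ∀ σ : k →+* ℂ, σ = τ ∨ σ = ComplexEmbedding.conjugate τ := fun σ =>
    QuarticCM.eq_or_eq_conjugate_of_quadratic h2 τ σ
  have hΨ : ∀ σ : k →+* ℂ, σ ∈ Ψ.1 ↔ σ = τ := by
    intro σ
    rcases hk σ with rfl | rfl
    · exact ⟨fun _ => rfl, fun _ => hτΨ⟩
    · exact ⟨fun h => absurd h ((Ψ.2 τ).1 hτΨ), fun h => absurd h hττ⟩
  -- `√−d ∈ 𝓞_k` with `τ(√−d) = i√d`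
  obtain ⟨δ₀, d, hd, hδ₀⟩ := CyclicSextic.exists_sq_eq_neg_nat_of_isTotallyComplex k h2
  obtain ⟨δ, hδ, hτ⟩ := exists_delta_of_mem h2 hd hδ₀ τ
  -- the frame in normal form; `2`-transitivity in frame form
  obtain ⟨e, c, he_sign, he_conj, hr₁, hr₂⟩ := exists_frameD h10 h2 i hττ hk Φ₁ Φ₂ h23₁ h23₂ hne
  have h2t := h2t_of_twoTransitive he_sign h2T
  -- the family `Kf = (k, K)` and the three slots `(k, K, K)`
  let Kf : Fin 2 → Type := Fin.cons k fun _ : Fin 1 => K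
  letI instF : ∀ j, Field (Kf j) := fun j =>
    Fin.cases (motive := fun j => Field (Kf j)) ‹Field k› (fun _ => ‹Field K›) j
  letI instN : ∀ j, NumberField (Kf j) := fun j =>
    Fin.cases (motive := fun j => NumberField (Kf j)) ‹NumberField k› (fun _ => ‹NumberField K›) j
  haveI instC : ∀ j, IsCMField (Kf j) := fun j =>
    Fin.cases (motive := fun j => IsCMField (Kf j)) ‹IsCMField k› (fun _ => ‹IsCMField K›) j
  exact hodgeConjectureFor_biproduct_comp_of_frameD_of_markmanSixfold_h2t (Kf := Kf) (i₀ := 0) (i₁ := 1) (c := c)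
    (A₃ := ![E, B₁, B₂])
    (Φ₃ := Fin.cons Ψ (Fin.cons Φ₁ (Fin.cons Φ₂ finZeroElim)))
    (ι₃ := Fin.cons ιE (Fin.cons ι₁ (Fin.cons ι₂ finZeroElim)))
    (θ₃ := Fin.cons θE (Fin.cons θ₁ (Fin.cons θ₂ finZeroElim))) hM6 κ h10 h2 i hd hδ hτ
    (Fin.cases hE (Fin.cases hB₁ (Fin.cases hB₂ fun l => l.elim0))) e he_sign he_conj
    (Fin.cases hr₁ (Fin.cases hr₂ fun l => l.elim0)) hΨ h2t

/-- **… and for every abelian variety dominated by such a product** (isogeny factors, quotients, abelian subvarieties of some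
`E^a × B₁^{n₁} × B₂^{n₂}`), `2`-transitive form. [cite: Markman2025SecantWeil, Thm 1.5.1] [cite: MumfordAV1970, §19] -/
theorem hodgeConjectureFor_of_avDominatedBy_comp_vec_of_markmanD_h2T
    (hM6 : Markman2025_weilClasses_algebraic_hyperbolicSixfold)
    (h10 : Module.finrank ℚ K = 10) (h2 : Module.finrank ℚ k = 2) (i : k →+* K)
    (hB₁ : IsCMTypeRealisation Φ₁ B₁ ι₁ θ₁) (hB₂ : IsCMTypeRealisation Φ₂ B₂ ι₂ θ₂) (hE : IsCMTypeRealisation Ψ E ιE θE)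
    {τ : k →+* ℂ} (hτΨ : τ ∈ Ψ.1)
    (h23₁ : (Finset.univ.filter fun s : K →+* ℂ => s.comp i = τ ∧ s ∈ Φ₁.1).card = 2)
    (h23₂ : (Finset.univ.filter fun s : K →+* ℂ => s.comp i = τ ∧ s ∈ Φ₂.1).card = 2) (hne : Φ₁ ≠ Φ₂)
    (h2T : ∀ x y : Fin 2 ↪ {s : K →+* ℂ // s.comp i = τ}, ∃ ρ : ℂ ≃+* ℂ, ∀ j : Fin 2, (ρ : ℂ →+* ℂ).comp (x j).1 = (y j).1)
    (κ : Fin N → Fin 3) {C : AbelianVariety ℂ}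
    (hC : Domination.AVDominatedBy C (⨁ fun j => (![E, B₁, B₂] : Fin 3 → AbelianVariety ℂ) (κ j))) :
    HodgeConjectureFor C.dim C.X :=
  Domination.hodgeConjectureFor_of_avDominatedBy
    (hodgeConjectureFor_biproduct_comp_vec_of_markmanD_h2T hM6 h10 h2 i hB₁ hB₂ hE hτΨ h23₁ h23₂ hne h2T κ) hC

end Main

end Summit.HodgeConjecture.CorCM.DecicWeil23Pair

end
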